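import Literature.NumberTheory.GaloisCohomology.Howard2004.CasselsTateSkewPairingPackageProofs
import Literature.NumberTheory.GaloisCohomology.Howard2004.DVRLevelLiftabilityAtLevelProofs
import HarnessLib

/-!
# Howard 2004, Thm. 1.4.2 at level `n`: the structure `H¹_{𝓕(n)}(K, T^{(k)}) ≅ R^{(k),ε} ⊕ M ⊕ M` of the
# MODIFIED Selmer groups from the skew pairings `( , )_{s,1}` of Prop. 1.4.1 — proofs file

Topic `NumberTheory/GaloisCohomology/Howard2004`. THEOREMS ONLY: no definition, no named fact, no instance, no
notation, no `sorry`. Sequel of `CasselsTateSkewPairingPackageProofs` (the generic step «skew pairings ⇒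
alternating level forms with kernel `V_{s-1}`», `levelForms_of_skewPairings`) and of `DVRLevelPairingPackageProofs`
(x10b-p1-w7 g6: the level package of `H¹_𝓕(K, T^{(k)})` from alternating level forms). Cell `pub/bsd-print-x9`,
seat `bsd-line-x9-p1` LEAD g9; print leaf G87 = `thm161_dvrKolyvaginBound` (Howard Thm. 1.6.1), registered
pseudo-stub `stub_h161` of the μ-crux `MuInequalityCoherentPair` (stmt-BirchSwinnertonDyer-22642).

WHY. Howard's induction for Lemma 1.6.4 (the tree's ENGINE `StubLemmaInduction.mem_stub_of_stubLemmaInduction_levels`,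
x10b-p1-w2 g15) runs over ALL the modules `𝓗^{(k)}(n) = H¹_{𝓕(n)}(K, T^{(k)})`, `n ∈ 𝓝(𝓛^{(k)})`
(arXiv:1202.6340 p0010 L50–60: «By Theorem 1.4.2 and Lemma 1.5.1, for each `n ∈ 𝓝` there is an `R`-module
`M(n)` and an integer `ε` such that `𝓗(n) ≅ R^ε ⊕ M(n) ⊕ M(n)`»), not only over `n = 1`; its instantiation on
the π-adic refinement (cell board «L164-FULL», input (α)) therefore needs Thm. 1.4.2 for every MODIFIED Selmer
structure `𝓕(n)` (the tree's `(S.t k).atLevel S.jbar n`, Def. 1.2.2). This file supplies that structure from the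
same printed input as at `n = 1` — the skew pairings of the display on p. 1449 — for ANY `R`-stable finite
subgroup `L ≤ H¹(K, T^{(k)})`, and specialises to `L = H¹_{𝓕(n)}(K, T^{(k)})`:

* §1 **`exists_levelPackage_of_levelForms_of_stable`** — GENERIC form of w7's one-level package: for an
  `R`-stable FINITE subgroup `L ≤ H¹(K, T^{(k)})` carrying, for each `t + 1 < e_k`, an alternating `R`-equivariant
  form on `L[π^{t+1}]` (values in a module with cyclic `π`-torsion) with kernel exactly `L[π^t] + π·L[π^{t+2}]`:
  `L ≃ₗ[R] (R/𝔪^{e_k})^ε × (M × M)`, `ε ≤ 1`, `M = Π_j R/(π^{n_j})`, `1 ≤ n_j ≤ e_k` (proof = w7's, verbatim with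
  `L` for `Sel_k`: `π^{e_k}` kills `H¹(K, T^{(k)})`, the algebra
  `Literature.Algebra.Module.exists_linearEquiv_pi_maximalIdeal_pow_prod_pi_prod_self_of_isAlt`).
* §2 **`exists_levelPackage_of_skewPairings_of_stable`** (§1 ∘ `levelForms_of_skewPairings`) and the level-`n`
  corollary **`exists_addEquiv_package_of_skewPairings_atLevel`**: for every `k` and every finite set of primes
  `n`, from the skew pairings `P_t : 𝓗(n)[π^{t+1}] × 𝓗(n)[π] → Q_t` (right kernel `π^{t+1}·𝓗(n)[π^{t+2}]`,
  `P(a, π^t b) = -P(b, π^t a)`) on `𝓗(n) = H¹_{𝓕(n)}(K, T^{(k)})`: `ε ≤ 1`, exponents `1 ≤ n_j ≤ e_k` and an additive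
  `R`-equivariant `θ : 𝓗(n) ≃ (R/𝔪^{e_k})^ε × (M × M)`, `M = Π_j R/(π^{n_j})` — EXACTLY the binder shape `(θ', hθ')`
  of the liftability step `exists_mem_selmerGroup_atLevel_eq_scalarMapH1_pow_of_incH1LE_eq` and of the other
  dischargers of the ENGINE's hypotheses (`R`-stability `scalarMapH1_mem_selmerGroup_atLevel`, finiteness
  `finite_selmerGroup_modify`).

HONEST FRAMING: Howard's Prop. 1.4.1 (Flach) and the skew-symmetry identity for `(T^{(k)}, 𝓕(n))` are NOT proved
here — they are the hypotheses `P / hP₁ / hP₂ / hright / hskew`; «`ε` is independent of `n`» (Prop. 1.5.5 via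
Lemma 1.5.3) is NOT asserted here (one `ε_{k,n} ≤ 1` per `(k, n)`); `thm161_dvrKolyvaginBound` is NOT proved; no
summit statement is proved; the Birch–Swinnerton-Dyer conjecture is not proved by any of this.

References: [Howard2004HeegnerKolyvagin] Prop. 1.4.1, Thm. 1.4.2, Lemma 1.5.1, display (1.5.x) «𝓗(n) ≅ R^ε ⊕ M(n) ⊕
M(n)», Thm. 1.6.1 (arXiv:1202.6340 pp. 8–12); [Flach1990] M. Flach, *A generalisation of the Cassels–Tate pairing*,
J. reine angew. Math. 412 (1990) 113–127.
-/

set_option autoImplicit false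

noncomputable section

open Function NumberField IsDedekindDomain Field Module Submodule
open scoped NumberField ContRepresentation Pointwise

namespace Literature.NumberTheory.GaloisCohomology.Howard2004

open Literature.NumberTheory.GaloisRepresentations
open Literature.NumberTheory.GaloisRepresentations.DiscreteGaloisModule
open Literature.Algebra.Module

namespace DVRSetting

variable {p : ℕ} [Fact p.Prime] {K : Type} [Field K] [NumberField K]
  {R : Type} [CommRing R] [IsDomain R] [IsDiscreteValuationRing R] [Algebra ℤ_[p] R]
  {N : ℕ → Type} [∀ k, AddCommGroup (N k)] [∀ k, TopologicalSpace (N k)]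
  [∀ k, DiscreteTopology (N k)] [∀ k, Module R (N k)]
  {Rk : ℕ → Type} [∀ k, CommRing (Rk k)] [∀ k, IsLocalRing (Rk k)] [∀ k, TopologicalSpace (Rk k)]
  [∀ k, DiscreteTopology (Rk k)] [∀ k, Algebra ℤ_[p] (Rk k)] [∀ k, Algebra R (Rk k)]
  [∀ k, Module (Rk k) (N k)] [∀ k, IsScalarTower R (Rk k) (N k)]
  {Nbar : Type} [AddCommGroup Nbar] [TopologicalSpace Nbar] [DiscreteTopology Nbar]
  [∀ k, Module (Rk k) Nbar]
  {Nq : ℕ → Finset (HeightOneSpectrum (𝓞 K)) → Type} [∀ k n, AddCommGroup (Nq k n)]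
  [∀ k n, TopologicalSpace (Nq k n)] [∀ k n, DiscreteTopology (Nq k n)]
  [∀ k n, Module (Rk k) (Nq k n)] [∀ k n, Module R (Nq k n)]
  [∀ k n, IsScalarTower R (Rk k) (Nq k n)]

/-! ## §1 One level, any `R`-stable finite subgroup: the package from alternating level forms -/

/-- **`L ≅ (R/𝔪^{e_k})^ε × (M × M)`, `ε ≤ 1`, from alternating level forms — for ANY `R`-stable finite subgroup
`L ≤ H¹(K, T^{(k)})`** (generic form of x10b-p1-w7's `exists_levelPackage_of_levelPairings`, whose proof this is,
with `L` in place of `H¹_𝓕(K, T^{(k)})`; Howard applies Thm. 1.4.2 to every `𝓗(n) = H¹_{𝓕(n)}(K, T^{(k)})`). Data: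
for each `t` an additive `R`-equivariant form `B_t` on `L[π^{t+1}] = L ⊓ ker π^{t+1}` with values in a module
with cyclic `π`-torsion, ALTERNATING for `t + 1 < e_k` and with kernel EXACTLY `L[π^t] + π·L[π^{t+2}]`. The
isomorphism is `R`-LINEAR for the functorial module structure `galoisCohomology.moduleH1` on `L`.
[cite: Howard2004HeegnerKolyvagin, Thm. 1.4.2 and §1.5 display «𝓗(n) ≅ R^ε ⊕ M(n) ⊕ M(n)» (arXiv:1202.6340 p0008 L100–L139, p0010 L50–L60)] -/
theorem exists_levelPackage_of_levelForms_of_stable (S : DVRSetting p K R N Rk Nbar Nq) (hy : S.SatisfiesH)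
    (k : ℕ) (L : AddSubgroup (galoisCohomology (S.T.ρ k) 1))
    (hL : ∀ (r : R) {x : galoisCohomology (S.T.ρ k) 1}, x ∈ L →
      galoisCohomology.scalarMapH1 (S.T.ρ k) (S.T.hlin k) r x ∈ L)
    (hfin : Finite ↥L)
    {P : ℕ → Type} [∀ t, AddCommGroup (P t)] [∀ t, Module R (P t)]
    (hP : ∀ t (a b : P t), S.π • a = 0 → S.π • b = 0 → a ≠ 0 → ∃ r : R, b = r • a)
    (B : ∀ t, ↥(L ⊓ (galoisCohomology.scalarMapH1 (S.T.ρ k) (S.T.hlin k) (S.π ^ (t + 1))).ker) →+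
      ↥(L ⊓ (galoisCohomology.scalarMapH1 (S.T.ρ k) (S.T.hlin k) (S.π ^ (t + 1))).ker) →+ P t)
    (hB₁ : ∀ t (r : R) (x x' y : ↥(L ⊓
        (galoisCohomology.scalarMapH1 (S.T.ρ k) (S.T.hlin k) (S.π ^ (t + 1))).ker)),
      (x' : galoisCohomology (S.T.ρ k) 1) =
        galoisCohomology.scalarMapH1 (S.T.ρ k) (S.T.hlin k) r (x : galoisCohomology (S.T.ρ k) 1) →
      B t x' y = r • B t x y)
    (hB₂ : ∀ t (r : R) (x y y' : ↥(L ⊓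
        (galoisCohomology.scalarMapH1 (S.T.ρ k) (S.T.hlin k) (S.π ^ (t + 1))).ker)),
      (y' : galoisCohomology (S.T.ρ k) 1) =
        galoisCohomology.scalarMapH1 (S.T.ρ k) (S.T.hlin k) r (y : galoisCohomology (S.T.ρ k) 1) →
      B t x y' = r • B t x y)
    (halt : ∀ t, t + 1 < S.e k → ∀ x, B t x x = 0)
    (hker : ∀ t, t + 1 < S.e k → ∀ x : ↥(L ⊓
        (galoisCohomology.scalarMapH1 (S.T.ρ k) (S.T.hlin k) (S.π ^ (t + 1))).ker),
      (∀ y, B t x y = 0) ↔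
        ∃ y ∈ L, ∃ z ∈ L,
          galoisCohomology.scalarMapH1 (S.T.ρ k) (S.T.hlin k) (S.π ^ t) y = 0 ∧
          galoisCohomology.scalarMapH1 (S.T.ρ k) (S.T.hlin k) (S.π ^ (t + 2)) z = 0 ∧
          (x : galoisCohomology (S.T.ρ k) 1) =
            y + galoisCohomology.scalarMapH1 (S.T.ρ k) (S.T.hlin k) S.π z) :
    letI := galoisCohomology.moduleH1 (S.T.ρ k) (S.T.hlin k)
    ∃ (ε m : ℕ) (n : Fin m → ℕ), ε ≤ 1 ∧ (∀ j, 1 ≤ n j ∧ n j ≤ S.e k) ∧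
      Nonempty (↥(galoisCohomology.submoduleOfStable (S.T.hlin k) L hL) ≃ₗ[R]
        ((Fin ε → R ⧸ IsLocalRing.maximalIdeal R ^ S.e k) ×
          ((Π j, R ⧸ Ideal.span {S.π ^ n j}) × (Π j, R ⧸ Ideal.span {S.π ^ n j})))) := by
  classical
  letI modH : Module R (galoisCohomology (S.T.ρ k) 1) := galoisCohomology.moduleH1 (S.T.ρ k) (S.T.hlin k)
  have hπm := S.π_mem_maximalIdeal hy
  have hirr : Irreducible S.π := (IsDiscreteValuationRing.irreducible_iff_uniformizer S.π).mpr hy.unif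
  have hsmul : ∀ (r : R) (x : galoisCohomology (S.T.ρ k) 1),
      r • x = galoisCohomology.scalarMapH1 (S.T.ρ k) (S.T.hlin k) r x := fun r x ↦ rfl
  -- the submodule `L'`
  set L' : Submodule R (galoisCohomology (S.T.ρ k) 1) :=
    galoisCohomology.submoduleOfStable (S.T.hlin k) L hL with hL'def
  have hLL : ∀ x : galoisCohomology (S.T.ρ k) 1, x ∈ L' ↔ x ∈ L := fun x ↦ Iff.rfl
  haveI : Module.Finite R ↥L' := by
    haveI : Finite ↥L' := Finite.of_equiv _ (Equiv.subtypeEquivRight (fun x ↦ (hLL x).symm))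
    exact Module.Finite.of_finite
  have hkill : ∀ x : ↥L', S.π ^ S.e k • x = 0 := fun x ↦ Subtype.ext (by
    rw [Submodule.coe_smul, Submodule.coe_zero]
    exact galoisCohomology.smul_eq_zero_of_forall (S.T.ρ k) (S.T.hlin k) _
      (fun m ↦ hy.killed k _ (Ideal.pow_mem_pow hπm _) m) _)
  -- `L'[π^{t+1}]` is the subgroup `L ⊓ ker(π^{t+1})` on which the forms live
  have hWV : ∀ t (w : ↥(torsionBy R ↥L' (S.π ^ (t + 1)))),
      ((w : ↥L') : galoisCohomology (S.T.ρ k) 1) ∈ L ⊓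
        (galoisCohomology.scalarMapH1 (S.T.ρ k) (S.T.hlin k) (S.π ^ (t + 1))).ker := fun t w ↦ by
    refine AddSubgroup.mem_inf.2 ⟨(w : ↥L').2, ?_⟩
    have h := (mem_torsionBy_iff _ _).1 w.2
    rw [Subtype.ext_iff, Submodule.coe_smul, Submodule.coe_zero, hsmul] at h
    exact h
  let toV : ∀ t, ↥(torsionBy R ↥L' (S.π ^ (t + 1))) →
      ↥(L ⊓ (galoisCohomology.scalarMapH1 (S.T.ρ k) (S.T.hlin k) (S.π ^ (t + 1))).ker) :=
    fun t w ↦ ⟨((w : ↥L') : galoisCohomology (S.T.ρ k) 1), hWV t w⟩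
  have htoV : ∀ t (w : ↥(torsionBy R ↥L' (S.π ^ (t + 1)))),
      (toV t w : galoisCohomology (S.T.ρ k) 1) = ((w : ↥L') : galoisCohomology (S.T.ρ k) 1) :=
    fun t w ↦ rfl
  have htoV_add : ∀ t (w w' : ↥(torsionBy R ↥L' (S.π ^ (t + 1)))),
      toV t (w + w') = toV t w + toV t w' := fun t w w' ↦ Subtype.ext rfl
  have htoV_smul : ∀ t (r : R) (w : ↥(torsionBy R ↥L' (S.π ^ (t + 1)))),
      (toV t (r • w) : galoisCohomology (S.T.ρ k) 1) =
        galoisCohomology.scalarMapH1 (S.T.ρ k) (S.T.hlin k) r (toV t w : galoisCohomology (S.T.ρ k) 1) :=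
    fun t r w ↦ rfl
  have htoV_surj : ∀ t (v : ↥(L ⊓
      (galoisCohomology.scalarMapH1 (S.T.ρ k) (S.T.hlin k) (S.π ^ (t + 1))).ker)),
      ∃ w, toV t w = v := fun t v ↦ by
    obtain ⟨hv₁, hv₂⟩ := AddSubgroup.mem_inf.1 v.2
    refine ⟨⟨⟨(v : galoisCohomology (S.T.ρ k) 1), hv₁⟩, ?_⟩, Subtype.ext rfl⟩
    rw [mem_torsionBy_iff, Subtype.ext_iff, Submodule.coe_smul, Submodule.coe_zero, hsmul]
    exact (AddMonoidHom.mem_ker).1 hv₂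
  -- the forms as `R`-bilinear maps on `L'[π^{t+1}]`
  let B' : ∀ t, ↥(torsionBy R ↥L' (S.π ^ (t + 1))) →ₗ[R] ↥(torsionBy R ↥L' (S.π ^ (t + 1))) →ₗ[R] P t :=
    fun t ↦ LinearMap.mk₂ R (fun a b ↦ B t (toV t a) (toV t b))
      (fun a₁ a₂ b ↦ by rw [htoV_add, map_add, AddMonoidHom.add_apply])
      (fun r a b ↦ hB₁ t r (toV t a) (toV t (r • a)) (toV t b) (htoV_smul t r a))
      (fun a b₁ b₂ ↦ by rw [htoV_add, map_add])
      (fun r a b ↦ hB₂ t r (toV t a) (toV t b) (toV t (r • b)) (htoV_smul t r b))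
  have hB'apply : ∀ t a b, B' t a b = B t (toV t a) (toV t b) := fun t a b ↦ rfl
  have halt' : ∀ t, t + 1 < S.e k → ∀ a, B' t a a = 0 := fun t ht a ↦ by
    rw [hB'apply]
    exact halt t ht _
  have hker' : ∀ t, t + 1 < S.e k → ∀ a : ↥(torsionBy R ↥L' (S.π ^ (t + 1))),
      (∀ b, B' t a b = 0) ↔ (a : ↥L') ∈ torsionBy R ↥L' (S.π ^ t) ⊔ S.π • torsionBy R ↥L' (S.π ^ (t + 2)) := by
    intro t ht a
    have step1 : (∀ b, B' t a b = 0) ↔ ∀ v, B t (toV t a) v = 0 := by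
      constructor
      · intro h v
        obtain ⟨w, rfl⟩ := htoV_surj t v
        rw [← hB'apply]
        exact h w
      · intro h b
        rw [hB'apply]
        exact h _
    rw [step1, hker t ht, mem_sup]
    constructor
    · rintro ⟨y, hy₁, z, hz₁, hy0, hz0, hyz⟩
      refine ⟨⟨y, hy₁⟩, ?_, S.π • ⟨z, hz₁⟩, smul_mem_pointwise_smul _ _ _ ?_, ?_⟩
      · rw [mem_torsionBy_iff, Subtype.ext_iff, Submodule.coe_smul, Submodule.coe_zero, hsmul]
        exact hy0
      · rw [mem_torsionBy_iff, Subtype.ext_iff, Submodule.coe_smul, Submodule.coe_zero, hsmul]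
        exact hz0
      · apply Subtype.ext
        rw [Submodule.coe_add, Submodule.coe_smul, hsmul, ← hyz]
    · rintro ⟨u, hu, w, hw, huw⟩
      obtain ⟨c, hc, rfl⟩ := (mem_smul_pointwise_iff_exists _ _ _).1 hw
      refine ⟨(u : galoisCohomology (S.T.ρ k) 1), u.2, (c : galoisCohomology (S.T.ρ k) 1), c.2, ?_, ?_, ?_⟩
      · have h := (mem_torsionBy_iff _ _).1 hu
        rw [Subtype.ext_iff, Submodule.coe_smul, Submodule.coe_zero, hsmul] at h
        exact h
      · have h := (mem_torsionBy_iff _ _).1 hc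
        rw [Subtype.ext_iff, Submodule.coe_smul, Submodule.coe_zero, hsmul] at h
        exact h
      · rw [htoV, ← huw, Submodule.coe_add, Submodule.coe_smul, hsmul]
  -- the algebra
  exact Literature.Algebra.Module.exists_linearEquiv_pi_maximalIdeal_pow_prod_pi_prod_self_of_isAlt hirr hkill
    hP B' halt' hker'

/-! ## §2 One level, any `R`-stable finite subgroup, and the modified Selmer groups `H¹_{𝓕(n)}(K, T^{(k)})`:
the package from the skew pairings -/

/-- **`L ≅ (R/𝔪^{e_k})^ε × (M × M)`, `ε ≤ 1`, from Howard's skew pairings `( , )_{s,1}` on an `R`-stable finite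
`L ≤ H¹(K, T^{(k)})`** (§1 ∘ `levelForms_of_skewPairings`): data `P_t : L[π^{t+1}] × L[π] → Q_t` bi-additive and
`R`-equivariant (`Q_t` with cyclic `π`-torsion), with right kernel exactly `π^{t+1}·L[π^{t+2}]` and
`P_t(a, π^t b) = -P_t(b, π^t a)` for `t + 1 < e_k`.
[cite: Howard2004HeegnerKolyvagin, Prop. 1.4.1, Thm. 1.4.2 (proof) and §1.5 display (arXiv:1202.6340 p0008 L83–L141, p0010 L50–L60)] -/
theorem exists_levelPackage_of_skewPairings_of_stable (S : DVRSetting p K R N Rk Nbar Nq) (hy : S.SatisfiesH)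
    (k : ℕ) (L : AddSubgroup (galoisCohomology (S.T.ρ k) 1))
    (hL : ∀ (r : R) {x : galoisCohomology (S.T.ρ k) 1}, x ∈ L →
      galoisCohomology.scalarMapH1 (S.T.ρ k) (S.T.hlin k) r x ∈ L)
    (hfin : Finite ↥L)
    {Q : ℕ → Type} [∀ t, AddCommGroup (Q t)] [∀ t, Module R (Q t)]
    (hQ : ∀ t (a b : Q t), S.π • a = 0 → S.π • b = 0 → a ≠ 0 → ∃ r : R, b = r • a)
    (P : ∀ t, ↥(L ⊓ (galoisCohomology.scalarMapH1 (S.T.ρ k) (S.T.hlin k) (S.π ^ (t + 1))).ker) →+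
      ↥(L ⊓ (galoisCohomology.scalarMapH1 (S.T.ρ k) (S.T.hlin k) S.π).ker) →+ Q t)
    (hP₁ : ∀ t (r : R) (x x' : ↥(L ⊓ (galoisCohomology.scalarMapH1 (S.T.ρ k) (S.T.hlin k) (S.π ^ (t + 1))).ker))
        (w : ↥(L ⊓ (galoisCohomology.scalarMapH1 (S.T.ρ k) (S.T.hlin k) S.π).ker)),
      (x' : galoisCohomology (S.T.ρ k) 1) =
        galoisCohomology.scalarMapH1 (S.T.ρ k) (S.T.hlin k) r (x : galoisCohomology (S.T.ρ k) 1) →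
      P t x' w = r • P t x w)
    (hP₂ : ∀ t (r : R) (x : ↥(L ⊓ (galoisCohomology.scalarMapH1 (S.T.ρ k) (S.T.hlin k) (S.π ^ (t + 1))).ker))
        (w w' : ↥(L ⊓ (galoisCohomology.scalarMapH1 (S.T.ρ k) (S.T.hlin k) S.π).ker)),
      (w' : galoisCohomology (S.T.ρ k) 1) =
        galoisCohomology.scalarMapH1 (S.T.ρ k) (S.T.hlin k) r (w : galoisCohomology (S.T.ρ k) 1) →
      P t x w' = r • P t x w)
    (hright : ∀ t, t + 1 < S.e k → ∀ w : ↥(L ⊓ (galoisCohomology.scalarMapH1 (S.T.ρ k) (S.T.hlin k) S.π).ker),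
      (∀ x, P t x w = 0) ↔
        ∃ z ∈ L, galoisCohomology.scalarMapH1 (S.T.ρ k) (S.T.hlin k) (S.π ^ (t + 2)) z = 0 ∧
          (w : galoisCohomology (S.T.ρ k) 1) =
            galoisCohomology.scalarMapH1 (S.T.ρ k) (S.T.hlin k) (S.π ^ (t + 1)) z)
    (hskew : ∀ t, t + 1 < S.e k →
      ∀ (a b : ↥(L ⊓ (galoisCohomology.scalarMapH1 (S.T.ρ k) (S.T.hlin k) (S.π ^ (t + 1))).ker))
        (a' b' : ↥(L ⊓ (galoisCohomology.scalarMapH1 (S.T.ρ k) (S.T.hlin k) S.π).ker)),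
      (a' : galoisCohomology (S.T.ρ k) 1) =
        galoisCohomology.scalarMapH1 (S.T.ρ k) (S.T.hlin k) (S.π ^ t) (a : galoisCohomology (S.T.ρ k) 1) →
      (b' : galoisCohomology (S.T.ρ k) 1) =
        galoisCohomology.scalarMapH1 (S.T.ρ k) (S.T.hlin k) (S.π ^ t) (b : galoisCohomology (S.T.ρ k) 1) →
      P t a b' = - P t b a') :
    letI := galoisCohomology.moduleH1 (S.T.ρ k) (S.T.hlin k)
    ∃ (ε m : ℕ) (n : Fin m → ℕ), ε ≤ 1 ∧ (∀ j, 1 ≤ n j ∧ n j ≤ S.e k) ∧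
      Nonempty (↥(galoisCohomology.submoduleOfStable (S.T.hlin k) L hL) ≃ₗ[R]
        ((Fin ε → R ⧸ IsLocalRing.maximalIdeal R ^ S.e k) ×
          ((Π j, R ⧸ Ideal.span {S.π ^ n j}) × (Π j, R ⧸ Ideal.span {S.π ^ n j})))) := by
  obtain ⟨B, hB₁, hB₂, halt, hker⟩ := S.levelForms_of_skewPairings hy k L hL P hP₁ hP₂ hright hskew
  exact S.exists_levelPackage_of_levelForms_of_stable hy k L hL hfin hQ B hB₁ hB₂ halt hker

/-- **HOWARD'S «`𝓗(n) ≅ R^ε ⊕ M(n) ⊕ M(n)`» AT LEVEL `n` FROM THE SKEW PAIRINGS `( , )_{s,1}` ON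
`𝓗(n) = H¹_{𝓕(n)}(K, T^{(k)})`.** On a `DVRSetting` with H.0–H.5, for every level `k` and every finite set of
primes `n` (the modified structure `𝓕(n)` = `(S.t k).atLevel S.jbar n`, Def. 1.2.2): from bi-additive
`R`-equivariant pairings `P_t : 𝓗(n)[π^{t+1}] × 𝓗(n)[π] → Q_t` (`Q_t` with cyclic `π`-torsion; Howard: `R[𝔪]`) with
right kernel exactly `π^{t+1}·𝓗(n)[π^{t+2}]` and `P_t(a, π^t b) = -P_t(b, π^t a)` for `t + 1 < e_k` (Prop. 1.4.1 +
the display of the proof of Thm. 1.4.2, for the triple `(T^{(k)}, 𝓕(n))` of Lemma 1.5.1), there are `ε ≤ 1`,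
exponents `1 ≤ n_j ≤ e_k` and an additive `R`-equivariant
`θ : H¹_{𝓕(n)}(K, T^{(k)}) ≃ (R/𝔪^{e_k})^ε × (M × M)`, `M = Π_j R/(π^{n_j})` — the binders `(θ', hθ')` of the
liftability step `exists_mem_selmerGroup_atLevel_eq_scalarMapH1_pow_of_incH1LE_eq` and of the ENGINE's
dischargers. (`R`-stability `scalarMapH1_mem_selmerGroup_atLevel`; finiteness `finite_selmerGroup_modify`.)
[cite: Howard2004HeegnerKolyvagin, Thm. 1.4.2, Lemma 1.5.1 and §1.5 display «𝓗(n) ≅ R^ε ⊕ M(n) ⊕ M(n)» (arXiv:1202.6340 p0008 L100–L141, p0009 L170–175, p0010 L50–L60)] -/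
theorem exists_addEquiv_package_of_skewPairings_atLevel (S : DVRSetting p K R N Rk Nbar Nq) (hy : S.SatisfiesH)
    (k : ℕ) (n : Finset (HeightOneSpectrum (𝓞 K)))
    {Q : ℕ → Type} [∀ t, AddCommGroup (Q t)] [∀ t, Module R (Q t)]
    (hQ : ∀ t (a b : Q t), S.π • a = 0 → S.π • b = 0 → a ≠ 0 → ∃ r : R, b = r • a)
    (P : ∀ t, ↥((((S.t k).atLevel S.jbar n).cond).selmerGroup ⊓
        (galoisCohomology.scalarMapH1 (S.T.ρ k) (S.T.hlin k) (S.π ^ (t + 1))).ker) →+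
      ↥((((S.t k).atLevel S.jbar n).cond).selmerGroup ⊓
        (galoisCohomology.scalarMapH1 (S.T.ρ k) (S.T.hlin k) S.π).ker) →+ Q t)
    (hP₁ : ∀ t (r : R) (x x' : ↥((((S.t k).atLevel S.jbar n).cond).selmerGroup ⊓
          (galoisCohomology.scalarMapH1 (S.T.ρ k) (S.T.hlin k) (S.π ^ (t + 1))).ker))
        (w : ↥((((S.t k).atLevel S.jbar n).cond).selmerGroup ⊓
          (galoisCohomology.scalarMapH1 (S.T.ρ k) (S.T.hlin k) S.π).ker)),
      (x' : galoisCohomology (S.T.ρ k) 1) =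
        galoisCohomology.scalarMapH1 (S.T.ρ k) (S.T.hlin k) r (x : galoisCohomology (S.T.ρ k) 1) →
      P t x' w = r • P t x w)
    (hP₂ : ∀ t (r : R) (x : ↥((((S.t k).atLevel S.jbar n).cond).selmerGroup ⊓
          (galoisCohomology.scalarMapH1 (S.T.ρ k) (S.T.hlin k) (S.π ^ (t + 1))).ker))
        (w w' : ↥((((S.t k).atLevel S.jbar n).cond).selmerGroup ⊓
          (galoisCohomology.scalarMapH1 (S.T.ρ k) (S.T.hlin k) S.π).ker)),
      (w' : galoisCohomology (S.T.ρ k) 1) =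
        galoisCohomology.scalarMapH1 (S.T.ρ k) (S.T.hlin k) r (w : galoisCohomology (S.T.ρ k) 1) →
      P t x w' = r • P t x w)
    (hright : ∀ t, t + 1 < S.e k → ∀ w : ↥((((S.t k).atLevel S.jbar n).cond).selmerGroup ⊓
          (galoisCohomology.scalarMapH1 (S.T.ρ k) (S.T.hlin k) S.π).ker),
      (∀ x, P t x w = 0) ↔
        ∃ z ∈ (((S.t k).atLevel S.jbar n).cond).selmerGroup,
          galoisCohomology.scalarMapH1 (S.T.ρ k) (S.T.hlin k) (S.π ^ (t + 2)) z = 0 ∧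
          (w : galoisCohomology (S.T.ρ k) 1) =
            galoisCohomology.scalarMapH1 (S.T.ρ k) (S.T.hlin k) (S.π ^ (t + 1)) z)
    (hskew : ∀ t, t + 1 < S.e k →
      ∀ (a b : ↥((((S.t k).atLevel S.jbar n).cond).selmerGroup ⊓
          (galoisCohomology.scalarMapH1 (S.T.ρ k) (S.T.hlin k) (S.π ^ (t + 1))).ker))
        (a' b' : ↥((((S.t k).atLevel S.jbar n).cond).selmerGroup ⊓
          (galoisCohomology.scalarMapH1 (S.T.ρ k) (S.T.hlin k) S.π).ker)),
      (a' : galoisCohomology (S.T.ρ k) 1) =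
        galoisCohomology.scalarMapH1 (S.T.ρ k) (S.T.hlin k) (S.π ^ t) (a : galoisCohomology (S.T.ρ k) 1) →
      (b' : galoisCohomology (S.T.ρ k) 1) =
        galoisCohomology.scalarMapH1 (S.T.ρ k) (S.T.hlin k) (S.π ^ t) (b : galoisCohomology (S.T.ρ k) 1) →
      P t a b' = - P t b a') :
    ∃ (ε m : ℕ) (nj : Fin m → ℕ), ε ≤ 1 ∧ (∀ j, 1 ≤ nj j ∧ nj j ≤ S.e k) ∧
      ∃ θ : ↥(((S.t k).atLevel S.jbar n).cond).selmerGroup ≃+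
          ((Fin ε → R ⧸ IsLocalRing.maximalIdeal R ^ S.e k) ×
            ((Π j, R ⧸ Ideal.span {S.π ^ nj j}) × (Π j, R ⧸ Ideal.span {S.π ^ nj j}))),
        ∀ (r : R) (y : galoisCohomology (S.T.ρ k) 1) (hy' : y ∈ (((S.t k).atLevel S.jbar n).cond).selmerGroup),
          θ ⟨galoisCohomology.scalarMapH1 (S.T.ρ k) (S.T.hlin k) r y,
              S.scalarMapH1_mem_selmerGroup_atLevel hy k n r hy'⟩ = r • θ ⟨y, hy'⟩ := by
  classical
  letI modH : Module R (galoisCohomology (S.T.ρ k) 1) := galoisCohomology.moduleH1 (S.T.ρ k) (S.T.hlin k)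
  have hsmul : ∀ (r : R) (x : galoisCohomology (S.T.ρ k) 1),
      r • x = galoisCohomology.scalarMapH1 (S.T.ρ k) (S.T.hlin k) r x := fun r x ↦ rfl
  have hL : ∀ (r : R) {x : galoisCohomology (S.T.ρ k) 1}, x ∈ (((S.t k).atLevel S.jbar n).cond).selmerGroup →
      galoisCohomology.scalarMapH1 (S.T.ρ k) (S.T.hlin k) r x ∈ (((S.t k).atLevel S.jbar n).cond).selmerGroup :=
    fun r _ hx ↦ S.scalarMapH1_mem_selmerGroup_atLevel hy k n r hx
  have hfin : Finite ↥(((S.t k).atLevel S.jbar n).cond).selmerGroup := S.finite_selmerGroup_modify hy k ∅ ∅ n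
  obtain ⟨ε, m, nj, hε, hnj, ⟨e⟩⟩ := S.exists_levelPackage_of_skewPairings_of_stable hy k
    (((S.t k).atLevel S.jbar n).cond).selmerGroup hL hfin hQ P hP₁ hP₂ hright hskew
  let L' : Submodule R (galoisCohomology (S.T.ρ k) 1) :=
    galoisCohomology.submoduleOfStable (S.T.hlin k) (((S.t k).atLevel S.jbar n).cond).selmerGroup hL
  have hLL : ∀ x : galoisCohomology (S.T.ρ k) 1,
      x ∈ L' ↔ x ∈ (((S.t k).atLevel S.jbar n).cond).selmerGroup := fun x ↦ Iff.rfl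
  let ι : ↥(((S.t k).atLevel S.jbar n).cond).selmerGroup ≃+ ↥L' :=
    { toFun := fun y ↦ ⟨(y : galoisCohomology (S.T.ρ k) 1), (hLL _).2 y.2⟩
      invFun := fun x ↦ ⟨(x : galoisCohomology (S.T.ρ k) 1), (hLL _).1 x.2⟩
      left_inv := fun _ ↦ rfl
      right_inv := fun _ ↦ rfl
      map_add' := fun _ _ ↦ rfl }
  refine ⟨ε, m, nj, hε, hnj, ι.trans e.toAddEquiv, fun r y hy' ↦ ?_⟩
  have h1 : ι ⟨galoisCohomology.scalarMapH1 (S.T.ρ k) (S.T.hlin k) r y,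
      S.scalarMapH1_mem_selmerGroup_atLevel hy k n r hy'⟩ = r • ι ⟨y, hy'⟩ :=
    Subtype.ext (by rw [Submodule.coe_smul, hsmul]; rfl)
  rw [AddEquiv.trans_apply, AddEquiv.trans_apply, h1, LinearEquiv.coe_toAddEquiv]
  exact map_smul e r _

end DVRSetting

end Literature.NumberTheory.GaloisCohomology.Howard2004
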